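/-
Copyright: statement-level skeleton of a published paper (lit-balaban cell, Phase-2 proof seat p19, gen 4). No claims beyond
what the kernel checks below.
-/
import Mathlib
import Literature.MathematicalPhysics.QuantumFieldTheory.Balaban1983to89.B3Prop21Except24Family
import Literature.MathematicalPhysics.QuantumFieldTheory.Balaban1983to89.B3Prop21Except24Example

/-!
# B3 — T. Bałaban, *(Higgs)₂,₃ quantum fields in a finite volume. III. Renormalization*, CMP **88** (1983) 411–445
[Balaban1983Higgs3] — Proposition 2.1 p. 424: the graph (2.4) is a member of the family `famIBP` and satisfies the PRINTED
hypothesis through the exception clause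

statement-level skeleton of published theorems with citation tags; proofs where landed; nothing here is a claim about
the Yang–Mills mass gap

PDF held: `paper:balaban1983-higgs-2-3-quantum-fields-finite-volume` (journal page = PDF page + 410).

Part of the Phase-2 work on SKELETON rows **B3.Prop2.1 / B3.Prop2.2** (unit `lit-balaban-p19` gen 4, HOME
`run/shared/lean/pub/lit-balaban/`), a worked member of the family of `B3Prop21Except24Family` built from the count datum
`graph24` of `B3Prop21Except24Example`.

WHAT IS REPRODUCED.  Proposition 2.1 p. 424 [PDF 14], verbatim: *"Let G be a connected graph such that its each connected
subgraph, with the possible exception of the subgraphs (2.4), has a positive degree."*  KERNEL-CHECKED HERE: the graph (2.4)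
(`graph24`: `d = 3`, one line carrying both derivative legs, degree `0`) is connected (`linesConnect_graph24`), hence a graph
`member24` of the expansion `expansionIBP (params24 Cmax CD) mb D` for every size bound `mb ≥ 1` and every analytic datum `D`;
its only connected subgraph along its only ordering is the (2.4)-block itself, so r15's PRINTED hypothesis
`B3Prop1.PosSubgraphsExcept24` HOLDS for it (`posSubgraphsExcept24_member24`) — through the exception clause `Is24`, not through
positivity (`not_pos_graph24`): the theorem `B3Prop21Except24.prop21_except24` therefore asserts (1.33) for the amplitudes of
(2.4), which the exception-free instances (`B3Prop21Instance`, `Is24 := False`) do not cover.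
-/

open Finset

namespace Literature.MathematicalPhysics.QuantumFieldTheory.Balaban1983to89.B3Ineq213

open B3Ineq215 B3Sect2FirstEstimate B3Prop1

/-- The lattice constants of the count datum `graph24` (`d = 3`, `L = 2`, `δ₁ = 1`) with arbitrary bounds `Cmax`, `CD` on the
constants of the amplitudes. [cite: Balaban1983Higgs3, Prop. 2.1 p.424] -/
def params24 (Cmax CD : ℝ) : ParamsIBP where
  d := 3
  L := 2
  δ₁ := 1
  Cmax := Cmax
  d_pos := by norm_num
  two_le_L := le_rfl
  δ₁_pos := one_pos
  CD := CD

/-- (2.4) is connected: its line joins its two vertices. [cite: Balaban1983Higgs3, (2.4) p.424] -/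
theorem linesConnect_graph24 : LinesConnect graph24.src graph24.tgt := by
  have h01 : Relation.EqvGen (fun a b : Fin 2 => ∃ l, graph24.src l = a ∧ graph24.tgt l = b) 0 1 :=
    Relation.EqvGen.rel _ _ ⟨0, rfl, rfl⟩
  intro u w
  fin_cases u <;> fin_cases w
  · exact Relation.EqvGen.refl _
  · exact h01
  · exact h01.symm
  · exact Relation.EqvGen.refl _

/-- **(2.4) is a graph of the expansion** at every size bound `mb ≥ 1`. [cite: Balaban1983Higgs3, Prop. 2.1 p.424] -/
noncomputable def member24 (Cmax CD : ℝ) {mb : ℕ} (h : 1 ≤ mb) : CGraphC (params24 Cmax CD).toParams mb where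
  n := 2
  m := 1
  m_le := h
  G := graph24
  d_eq := rfl
  L_eq := rfl
  δ₁_eq := rfl
  conn := linesConnect_graph24

/-- A one-line graph has one ordering: relabelling along a permutation of `Fin 1` does nothing. [cite: Balaban1983Higgs3, (2.7) p.424] -/
theorem relabelCounts_graph24 (σ : Equiv.Perm (Fin 1)) : relabelCounts graph24 σ = graph24 := rfl

/-- **The PRINTED hypothesis of Proposition 2.1 holds for (2.4)** in the family — through the exception clause: its only
connected subgraph (the block of `G₁ = G` along the only ordering) is the (2.4)-block `is24Block_graph24`, of degree `0`.
[cite: Balaban1983Higgs3, Prop. 2.1 p.424] -/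
theorem posSubgraphsExcept24_member24 (Cmax CD : ℝ) {mb : ℕ} (h : 1 ≤ mb) (D : DatumIBP (params24 Cmax CD)) :
    PosSubgraphsExcept24 (expansionIBP (params24 Cmax CD) mb D) (member24 Cmax CD h) := by
  refine ⟨trivial, ?_⟩
  show ∀ H : Component graph24,
    Is24Block (relabelCounts graph24 H.1) H.2.1 H.2.2.1 ∨ 0 < degQ (relabelCounts graph24 H.1) H.2.1 H.2.2.1
  rintro ⟨σ, i, b, hb, hn⟩
  left
  change Is24Block (relabelCounts graph24 σ) i b
  rw [relabelCounts_graph24] at hb hn ⊢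
  have hi : (i : ℕ) = 0 ∨ (i : ℕ) = 1 := by have := i.isLt; omega
  rcases hi with hi | hi <;> rw [hi] at hb hn ⊢
  · exact absurd hn (by simp [Model.Nontriv, Model.before_zero])
  · have hb0 : b = 0 := by have := graph24.toModel.mem_reps.1 hb; rw [rep_one_graph24] at this; exact this.symm
    subst hb0
    exact is24Block_graph24

/-- … while the exception-free positivity hypothesis fails for this member (its block has degree `0`).
[cite: Balaban1983Higgs3, Prop. 2.1 p.424] -/
theorem not_posSubgraphs_member24 (Cmax CD : ℝ) {mb : ℕ} (h : 1 ≤ mb) (D : DatumIBP (params24 Cmax CD)) :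
    ¬ ∀ H : (expansionIBP (params24 Cmax CD) mb D).Sub (member24 Cmax CD h),
        0 < (expansionIBP (params24 Cmax CD) mb D).subDeg (member24 Cmax CD h) H := by
  intro hall
  change ∀ H : Component graph24, 0 < degQ (relabelCounts graph24 H.1) H.2.1 H.2.2.1 at hall
  have hrep : (0 : Fin 2) ∈ (relabelCounts graph24 1).toModel.reps ((1 : Fin 2) : ℕ) := by
    rw [relabelCounts_graph24, Model.mem_reps]; exact rep_one_graph24 0
  have hnt : (relabelCounts graph24 1).toModel.Nontriv ((1 : Fin 2) : ℕ) 0 := by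
    rw [relabelCounts_graph24]; change (graph24.toModel.before 1 0).Nonempty
    rw [before_one_graph24]; exact singleton_nonempty 0
  have h1 := hall ⟨1, 1, 0, hrep, hnt⟩
  change 0 < degQ (relabelCounts graph24 1) ((1 : Fin 2) : ℕ) 0 at h1
  rw [relabelCounts_graph24, Fin.val_one, degQ_graph24] at h1
  exact lt_irrefl 0 h1

end Literature.MathematicalPhysics.QuantumFieldTheory.Balaban1983to89.B3Ineq213
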